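import Summits.QuantumFields.YangMills.Theorems.UnitScaleTiltFluctuationComparisonRegPrGlobalSlackKernelRescale
import HarnessLib

/-!
# `UnitScaleTiltFluctuationComparisonRegPrGlobalSlackKernelRescaleTransfer` — THE COLLAR POLYLOGARITHM IS PAID BY THE BIRTH COUPLING, II: honest rows for `(Φ, B)` ⟹
# rows of record for the rescaled pair; the landed composition applies by name (crux `FluctuationComparisonRegPrL`, stmt-QuantumFields-19935, STUB 3⁗; lane A)

PORT (prover seat ym-ust-19935-slack g0) of ym-cruxidea-19201-1 g14's crux sketch `Cruxes/FluctuationComparisonRegPr/Sketch_ideator1_g14.lean` (sha16 196e545072150834, F-idea1-g14-1, farm rc 0), namespace `Summit.QuantumFields.YangMills.Theorems.GlobalSlackKernelRescale`; statements and proofs verbatim, split in three files.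

* §4 `taylorSplitΦ_rescale` (same `PT, e, R`), `cfgSizeΦ_rescale`, `cfgCauchyΦ_rescale` (exact), `cfgCauchyΦ_rate_mono`, `kernelSizeΦ_rescale` (`C_E ↦ C_E·M(6r₀,1)`),
  `flatKernelCauchyΦ_rescale_g` (lossless from the `g`-carrying K1a), `flatKernelCauchyΦ_rescale` (K1a verbatim + `KernelSizeΦg` ⟹ K1a for the rescaled chart at rate
  `a(1−t)`), `polymerCauchyMinAtTSlack_of_honest_charts(_g)` (by name through `GlobalSlackKernelMatching.polymerCauchyMinAtTSlack_of_charts`);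
* §5a coupling arithmetic along the tower: `log_inv_gCo_add`, `collarW_add_le`, `collarW_pow_mul_gCo_le'`.
Nothing of [Balaban1985UV3]/[King1986] is asserted.

References: T. Bałaban, CMP 102 (1985) 255–275 [Balaban1985UV3] ((28) p.263, (34) p.264); C. King, CMP 102 (1986) 649–677 [King1986] (Thm 3.4 (3.9) p.656, Prop. 3.6 p.662).
-/

noncomputable section

open scoped BigOperators
open Literature.MathematicalPhysics.QuantumFieldTheory.Balaban1983to89
open Literature.MathematicalPhysics.QuantumFieldTheory.Balaban1983to89.T3ContinuumYM3Torus
open Literature.MathematicalPhysics.QuantumFieldTheory.Balaban1983to89.T3UnitScaleTilt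
open Literature.MathematicalPhysics.QuantumFieldTheory.Balaban1983to89.T3LevelShift
open Literature.MathematicalPhysics.QuantumFieldTheory.Balaban1983to89.T3AlphaInputsAC
open Literature.MathematicalPhysics.QuantumFieldTheory.Balaban1983to89.T3AlphaPolymerSocket
open Literature.MathematicalPhysics.QuantumFieldTheory.Balaban1983to89.T3AlphaInputsACTwoRun
open Literature.MathematicalPhysics.QuantumFieldTheory.Balaban1983to89.T3AlphaInputsACTwoRunLevel
open Literature.MathematicalPhysics.QuantumFieldTheory.Balaban1985CMP102.Binders (ChartAnalyticityAsCited)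
open Summit.QuantumFields.Balaban3D.Carriers
open Summit.QuantumFields.Balaban3D.Proofs.Primitives
open Summit.QuantumFields.Balaban3D.Proofs.GroupModelLieC (lieC)
open Summit.QuantumFields.YangMills.Theorems
open Summit.QuantumFields.YangMills.Theorems.GlobalSlack (GlobalSupRateTSlack)
open Summit.QuantumFields.Balaban3D.Proofs.Representation33 (jet26)
open Summit.QuantumFields.YangMills.Theorems.GlobalSlackKernelMatching

namespace Summit.QuantumFields.YangMills.Theorems.GlobalSlackKernelRescale

/-! ## §4 Transfer: honest rows for `(Φ, B)` ⟹ rows of record for `(Φ̃, B̃)`; the landed composition applies by name -/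

section Transfer

variable {𝕍 : Type} [NormedAddCommGroup 𝕍] [NormedSpace ℂ 𝕍] {F : T3Family} {γ : ℝ}

/-- The structure row is invariant: `TaylorSplitΦ PT Φ e B R → TaylorSplitΦ PT Φ̃ e B̃ R` (same `PT, e, R`). [cite: Balaban1985UV3, (30) p.263] -/
theorem taylorSplitΦ_rescale (w : ℕ → ℝ) (hw : ∀ i, w i ≠ 0) {PT : TermFn F} {Φ : ChartFam 𝕍 F} {e : VacFam F} {B : CfgFam 𝕍 F}
    {R : RemFam F} (hT : TaylorSplitΦ PT Φ e B R) : TaylorSplitΦ PT (rescaleΦ w Φ) e (rescaleB w B) R := by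
  intro K k b Y W
  have hj : jet26 (rescaleΦ w Φ K b Y) (rescaleB w B K k b Y W) = jet26 (Φ K b Y) (B K k b Y W) :=
    jet26_comp_smul (Φ K b Y) (Complex.ofReal_ne_zero.mpr (hw (K - b))) (B K k b Y W)
  rw [hj]
  exact hT K k b Y W

/-- `CfgSizeΦr D B … r₀ C_s → CfgSizeΦ D B̃ … C_s`. [cite: Balaban1985UV3, (28) p.263] -/
theorem cfgSizeΦ_rescale {D : AlphaDataT3 F γ} {B : CfgFam 𝕍 F} {b₀ p₀ r₀ C_s : ℝ} (hL : 1 ≤ F.L) (hγ : 0 < γ) (hγ1 : γ ≤ 1)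
    (hr : 0 ≤ r₀) (hS : CfgSizeΦr D B b₀ p₀ r₀ C_s) : CfgSizeΦ D (rescaleB (collarW F.L γ r₀) B) b₀ p₀ C_s := by
  intro K n hn j hj V hV Y hY
  obtain ⟨h1, h2⟩ := hS K n hn j hj V hV Y hY
  have hw := collarW_pos hL hγ hγ1 hr (K - j)
  have hidx : K + 1 - (j + 1) = K - j := by omega
  have hnorm : ‖((collarW F.L γ r₀ (K - j) : ℝ) : ℂ)⁻¹‖ = (collarW F.L γ r₀ (K - j))⁻¹ := by
    rw [norm_inv, Complex.norm_real, Real.norm_of_nonneg hw.le]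
  simp only [rescaleB, Pi.smul_apply, hidx]
  refine ⟨?_, ?_⟩
  · rw [norm_smul, hnorm, inv_mul_le_iff₀ hw]
    exact h1
  · rw [norm_smul_pullback, hnorm, inv_mul_le_iff₀ hw]
    exact h2

/-- `CfgCauchyΦr D B … r₀ a C_B ℓ → CfgCauchyΦ D B̃ … a C_B ℓ`. [cite: King1986, Prop. 3.9 (3.71) p.665] -/
theorem cfgCauchyΦ_rescale {D : AlphaDataT3 F γ} {B : CfgFam 𝕍 F} {b₀ p₀ r₀ a C_B : ℝ} {ℓ : ℕ → ℝ} (hL : 1 ≤ F.L)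
    (hγ : 0 < γ) (hγ1 : γ ≤ 1) (hr : 0 ≤ r₀) (hBC : CfgCauchyΦr D B b₀ p₀ r₀ a C_B ℓ) :
    CfgCauchyΦ D (rescaleB (collarW F.L γ r₀) B) b₀ p₀ a C_B ℓ := by
  intro K n hn j hj V hV Y hY
  have h := hBC K n hn j hj V hV Y hY
  have hw := collarW_pos hL hγ hγ1 hr (K - j)
  have hidx : K + 1 - (j + 1) = K - j := by omega
  have hnorm : ‖((collarW F.L γ r₀ (K - j) : ℝ) : ℂ)⁻¹‖ = (collarW F.L γ r₀ (K - j))⁻¹ := by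
    rw [norm_inv, Complex.norm_real, Real.norm_of_nonneg hw.le]
  simp only [rescaleB, Pi.smul_apply, hidx]
  rw [norm_smul_pullback_sub, hnorm, inv_mul_le_iff₀ hw]
  exact h

omit [NormedSpace ℂ 𝕍] in
/-- Rate monotonicity of the configuration Cauchy row: `a' ≤ a` (with `C_B, θ, ℓ ≥ 0`, `L ≥ 1`). [folklore] -/
theorem cfgCauchyΦ_rate_mono {D : AlphaDataT3 F γ} {B : CfgFam 𝕍 F} {b₀ p₀ a a' C_B : ℝ} {ℓ : ℕ → ℝ} (hL : 1 ≤ F.L)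
    (hCB : 0 ≤ C_B) (hθ0 : ∀ n, 0 ≤ θBal F.L γ b₀ p₀ n) (hℓ : ∀ n, 0 ≤ ℓ n) (ha : a' ≤ a)
    (hBC : CfgCauchyΦ D B b₀ p₀ a C_B ℓ) : CfgCauchyΦ D B b₀ p₀ a' C_B ℓ := by
  intro K n hn j hj V hV Y hY
  refine (hBC K n hn j hj V hV Y hY).trans ?_
  have hL' : (1 : ℝ) ≤ F.L := by exact_mod_cast hL
  have hx0 : 0 < ((F.L : ℝ) ^ (1 + j))⁻¹ := inv_pos.mpr (pow_pos (by linarith) _)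
  have hx1 : ((F.L : ℝ) ^ (1 + j))⁻¹ ≤ 1 := inv_le_one_of_one_le₀ (one_le_pow₀ hL')
  have hmono : ((F.L : ℝ) ^ (1 + j))⁻¹ ^ a ≤ ((F.L : ℝ) ^ (1 + j))⁻¹ ^ a' := Real.rpow_le_rpow_of_exponent_ge hx0 hx1 ha
  have h0 : 0 ≤ C_B * θBal F.L γ b₀ p₀ n * (((F.L : ℝ) ^ (K - n - 1 - j))⁻¹) ^ 2 :=
    mul_nonneg (mul_nonneg hCB (hθ0 n)) (pow_nonneg (inv_nonneg.mpr (pow_nonneg (by linarith) _)) 2)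
  exact mul_le_mul_of_nonneg_left (mul_le_mul_of_nonneg_left hmono (hℓ n)) h0

/-- `KernelSizeΦg D Φ κ C_E → KernelSizeΦ D Φ̃ κ (C_E·M(6r₀,1))` — the coupling pays the collar. [cite: Balaban1985UV3, Prop. 3 (34) p.264] -/
theorem kernelSizeΦ_rescale {D : AlphaDataT3 F γ} {Φ : ChartFam 𝕍 F} {κ C_E r₀ : ℝ} (hL : 1 ≤ F.L) (hγ : 0 < γ) (hγ1 : γ ≤ 1)
    (hr : 0 ≤ r₀) (hCE : 0 ≤ C_E) (hE : KernelSizeΦg D Φ κ C_E) :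
    KernelSizeΦ D (rescaleΦ (collarW F.L γ r₀) Φ) κ (C_E * logPowConst (6 * r₀) 1) := by
  intro K k b Y hY d hd
  have hd6 : d ≤ 6 := by have := (Finset.mem_Ico.1 hd).2; omega
  obtain ⟨h1, -⟩ := hE K k b Y hY d hd
  have hw0 : ∀ i, collarW F.L γ r₀ i ≠ 0 := fun i => (collarW_pos hL hγ hγ1 hr i).ne'
  have hwpos := collarW_pos hL hγ hγ1 hr (K - b)
  rw [ker_rescale _ hw0, norm_smul, norm_pow, Complex.norm_real, Real.norm_of_nonneg hwpos.le]
  have key : collarW F.L γ r₀ (K - b) ^ d * gCo F.L γ (K - b) ≤ logPowConst (6 * r₀) 1 :=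
    collarW_pow_mul_gCo_le hL hγ hγ1 hr hd6 _
  have hex : 0 ≤ Real.exp (-κ * D.treeLen K (1 + b) Y) := (Real.exp_pos _).le
  calc collarW F.L γ r₀ (K - b) ^ d * ‖ker Φ K b Y d‖
      ≤ collarW F.L γ r₀ (K - b) ^ d * (C_E * gCo F.L γ (K - b) * Real.exp (-κ * D.treeLen K (1 + b) Y)) :=
        mul_le_mul_of_nonneg_left h1 (pow_nonneg hwpos.le d)
    _ = C_E * (collarW F.L γ r₀ (K - b) ^ d * gCo F.L γ (K - b)) * Real.exp (-κ * D.treeLen K (1 + b) Y) := by ring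
    _ ≤ C_E * logPowConst (6 * r₀) 1 * Real.exp (-κ * D.treeLen K (1 + b) Y) :=
        mul_le_mul_of_nonneg_right (mul_le_mul_of_nonneg_left key hCE) hex

/-- LOSSLESS K1a transfer: `FlatKernelCauchyΦg D Φ κ a C → FlatKernelCauchyΦ D Φ̃ κ a (C·M(6r₀,1))`. [cite: King1986, Prop. 3.6 (3.56) p.662] -/
theorem flatKernelCauchyΦ_rescale_g {D : AlphaDataT3 F γ} {Φ : ChartFam 𝕍 F} {κ a C r₀ : ℝ} (hL : 1 ≤ F.L) (hγ : 0 < γ)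
    (hγ1 : γ ≤ 1) (hr : 0 ≤ r₀) (hC : 0 ≤ C) (hK : FlatKernelCauchyΦg D Φ κ a C) :
    FlatKernelCauchyΦ D (rescaleΦ (collarW F.L γ r₀) Φ) κ a (C * logPowConst (6 * r₀) 1) := by
  intro K k b Y hY d hd
  have hd6 : d ≤ 6 := by have := (Finset.mem_Ico.1 hd).2; omega
  have h1 := hK K k b Y hY d hd
  have hw0 : ∀ i, collarW F.L γ r₀ i ≠ 0 := fun i => (collarW_pos hL hγ hγ1 hr i).ne'
  have hwpos := collarW_pos hL hγ hγ1 hr (K - b)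
  rw [kerT_rescale _ hw0, ker_rescale _ hw0, ← smul_sub_rescale, norm_smul, norm_pow, Complex.norm_real,
    Real.norm_of_nonneg hwpos.le]
  have key : collarW F.L γ r₀ (K - b) ^ d * gCo F.L γ (K - b) ≤ logPowConst (6 * r₀) 1 :=
    collarW_pow_mul_gCo_le hL hγ hγ1 hr hd6 _
  have hex : 0 ≤ Real.exp (-κ * D.treeLen K (1 + b) Y) := (Real.exp_pos _).le
  have hx : 0 ≤ (((F.L : ℝ) ^ (1 + b))⁻¹) ^ a := Real.rpow_nonneg (inv_nonneg.mpr (pow_nonneg (Nat.cast_nonneg _) _)) _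
  calc collarW F.L γ r₀ (K - b) ^ d * ‖kerT Φ K b Y d - ker Φ K b Y d‖
      ≤ collarW F.L γ r₀ (K - b) ^ d *
          (C * gCo F.L γ (K - b) * Real.exp (-κ * D.treeLen K (1 + b) Y) * (((F.L : ℝ) ^ (1 + b))⁻¹) ^ a) :=
        mul_le_mul_of_nonneg_left h1 (pow_nonneg hwpos.le d)
    _ = C * (collarW F.L γ r₀ (K - b) ^ d * gCo F.L γ (K - b)) * Real.exp (-κ * D.treeLen K (1 + b) Y) *
          (((F.L : ℝ) ^ (1 + b))⁻¹) ^ a := by ring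
    _ ≤ C * logPowConst (6 * r₀) 1 * Real.exp (-κ * D.treeLen K (1 + b) Y) * (((F.L : ℝ) ^ (1 + b))⁻¹) ^ a :=
        mul_le_mul_of_nonneg_right (mul_le_mul_of_nonneg_right (mul_le_mul_of_nonneg_left key hC) hex) hx

/-- INTERPOLATED K1a transfer from the VERBATIM row of record: `FlatKernelCauchyΦ D Φ κ a C ∧ KernelSizeΦg D Φ κ C_E →
FlatKernelCauchyΦ D Φ̃ κ (a(1-t)) (C^{1-t}(2C_E)^t·M(6r₀,t))` for `0 < t ≤ 1`. [cite: King1986, Prop. 3.6 (3.56) p.662] -/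
theorem flatKernelCauchyΦ_rescale {D : AlphaDataT3 F γ} {Φ : ChartFam 𝕍 F} {κ a C C_E r₀ t : ℝ} (hL : 1 ≤ F.L) (hγ : 0 < γ)
    (hγ1 : γ ≤ 1) (hr : 0 ≤ r₀) (hC : 0 ≤ C) (hCE : 0 ≤ C_E) (ht : 0 < t) (ht1 : t ≤ 1)
    (hK : FlatKernelCauchyΦ D Φ κ a C) (hE : KernelSizeΦg D Φ κ C_E) :
    FlatKernelCauchyΦ D (rescaleΦ (collarW F.L γ r₀) Φ) κ (a * (1 - t))
      (C ^ (1 - t) * (2 * C_E) ^ t * logPowConst (6 * r₀) t) := by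
  intro K k b Y hY d hd
  have hd6 : d ≤ 6 := by have := (Finset.mem_Ico.1 hd).2; omega
  have hN := hK K k b Y hY d hd
  obtain ⟨h1, h2⟩ := hE K k b Y hY d hd
  have hw0 : ∀ i, collarW F.L γ r₀ i ≠ 0 := fun i => (collarW_pos hL hγ hγ1 hr i).ne'
  have hwpos := collarW_pos hL hγ hγ1 hr (K - b)
  rw [kerT_rescale _ hw0, ker_rescale _ hw0, ← smul_sub_rescale, norm_smul, norm_pow, Complex.norm_real,
    Real.norm_of_nonneg hwpos.le]
  set w := collarW F.L γ r₀ (K - b) with hw_def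
  set g := gCo F.L γ (K - b) with hg_def
  set ex := Real.exp (-κ * D.treeLen K (1 + b) Y) with hex_def
  set x := ((F.L : ℝ) ^ (1 + b))⁻¹ with hx_def
  set N := ‖kerT Φ K b Y d - ker Φ K b Y d‖ with hN_def
  have hx0 : 0 ≤ x := inv_nonneg.mpr (pow_nonneg (Nat.cast_nonneg _) _)
  have hg0 : 0 < g := gCo_pos hL hγ _
  have hex : 0 < ex := Real.exp_pos _
  have hN2 : N ≤ 2 * C_E * g * ex := by
    calc N ≤ ‖kerT Φ K b Y d‖ + ‖ker Φ K b Y d‖ := norm_sub_le _ _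
      _ ≤ C_E * g * ex + C_E * g * ex := add_le_add h2 h1
      _ = 2 * C_E * g * ex := by ring
  have hA0 : 0 ≤ C * ex * x ^ a := mul_nonneg (mul_nonneg hC hex.le) (Real.rpow_nonneg hx0 _)
  have h2CE : 0 ≤ 2 * C_E := by linarith
  have hB0 : 0 ≤ 2 * C_E * g * ex := mul_nonneg (mul_nonneg h2CE hg0.le) hex.le
  have hmin : N ≤ min (C * ex * x ^ a) (2 * C_E * g * ex) := le_min hN hN2
  have hint := min_le_rpow_mul_rpow hA0 hB0 ht.le ht1
  have hee : ex ^ (1 - t) * ex ^ t = ex := by rw [← Real.rpow_add hex, sub_add_cancel, Real.rpow_one]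
  have hexp : (C * ex * x ^ a) ^ (1 - t) * (2 * C_E * g * ex) ^ t =
      C ^ (1 - t) * (2 * C_E) ^ t * g ^ t * ex * x ^ (a * (1 - t)) := by
    rw [Real.mul_rpow (mul_nonneg hC hex.le) (Real.rpow_nonneg hx0 _), Real.mul_rpow hC hex.le,
      Real.mul_rpow (mul_nonneg h2CE hg0.le) hex.le, Real.mul_rpow h2CE hg0.le, ← Real.rpow_mul hx0]
    calc C ^ (1 - t) * ex ^ (1 - t) * x ^ (a * (1 - t)) * ((2 * C_E) ^ t * g ^ t * ex ^ t)
        = C ^ (1 - t) * (2 * C_E) ^ t * g ^ t * (ex ^ (1 - t) * ex ^ t) * x ^ (a * (1 - t)) := by ring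
      _ = C ^ (1 - t) * (2 * C_E) ^ t * g ^ t * ex * x ^ (a * (1 - t)) := by rw [hee]
  have key : w ^ d * g ^ t ≤ logPowConst (6 * r₀) t := collarW_pow_mul_gCo_rpow_le hL hγ hγ1 hr hd6 _ ht
  have hc0 : 0 ≤ C ^ (1 - t) * (2 * C_E) ^ t := mul_nonneg (Real.rpow_nonneg hC _) (Real.rpow_nonneg h2CE _)
  calc w ^ d * N ≤ w ^ d * (C ^ (1 - t) * (2 * C_E) ^ t * g ^ t * ex * x ^ (a * (1 - t))) := by
        refine mul_le_mul_of_nonneg_left ?_ (pow_nonneg hwpos.le d)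
        calc N ≤ min (C * ex * x ^ a) (2 * C_E * g * ex) := hmin
          _ ≤ (C * ex * x ^ a) ^ (1 - t) * (2 * C_E * g * ex) ^ t := hint
          _ = _ := hexp
    _ = C ^ (1 - t) * (2 * C_E) ^ t * (w ^ d * g ^ t) * ex * x ^ (a * (1 - t)) := by ring
    _ ≤ C ^ (1 - t) * (2 * C_E) ^ t * logPowConst (6 * r₀) t * ex * x ^ (a * (1 - t)) :=
        mul_le_mul_of_nonneg_right (mul_le_mul_of_nonneg_right (mul_le_mul_of_nonneg_left key hc0) hex.le)
          (Real.rpow_nonneg hx0 _)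

/-- **THE LANDED COMPOSITION APPLIES BY NAME — LOSSLESS FORM** (`g`-carrying K1a): honest rows for `(Φ, B)` ⟹ the local slack row of 3⁗'s producer at
`σ = 7`, profile `θBal(b₀, p₀)`, rate `a`. [cite: King1986, Prop. 3.6 (3.56) p.662; Balaban1985UV3, (28) p.263, (34) p.264] -/
theorem polymerCauchyMinAtTSlack_of_honest_charts_g {D : AlphaDataT3 F γ} {PT : TermFn F} {Φ : ChartFam 𝕍 F} {e : VacFam F}
    {B : CfgFam 𝕍 F} {R : RemFam F} {b₀ p₀ κ a C C_E C_R C_s C_B r₀ : ℝ}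
    (hC : 0 ≤ C) (hCE : 0 ≤ C_E) (hCR : 0 ≤ C_R) (hCs : 0 ≤ C_s) (hCB : 0 ≤ C_B) (hL : 1 ≤ F.L) (hγ : 0 < γ) (hγ1 : γ ≤ 1)
    (hr : 0 ≤ r₀) (hθ0 : ∀ n, 0 ≤ θBal F.L γ b₀ p₀ n) (hθ1 : ∀ n, (C_s + C_B) * θBal F.L γ b₀ p₀ n ≤ 1)
    (hT : TaylorSplitΦ PT Φ e B R) (hK : FlatKernelCauchyΦg D Φ κ a C) (hE : KernelSizeΦg D Φ κ C_E)
    (hR : RemainderSmallΦ D R b₀ p₀ κ C_R) (hS : CfgSizeΦr D B b₀ p₀ r₀ C_s) (hBC : CfgCauchyΦr D B b₀ p₀ r₀ a C_B fun _ => 1) :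
    PolymerCauchyMinAtTSlack D PT b₀ p₀ κ a 7
      (5 * (C_s ^ 2 * (C * logPowConst (6 * r₀) 1) + 6 * C_s * C_B * (C_E * logPowConst (6 * r₀) 1)) + 2 * C_R) := by
  have hL' : 1 ≤ (F.L : ℝ) := by exact_mod_cast hL
  have hw0 : ∀ i, collarW F.L γ r₀ i ≠ 0 := fun i => (collarW_pos hL hγ hγ1 hr i).ne'
  have hM : 0 ≤ logPowConst (6 * r₀) 1 := (logPowConst_pos (by nlinarith) one_pos).le
  exact polymerCauchyMinAtTSlack_of_charts (mul_nonneg hC hM) (mul_nonneg hCE hM) hCR hCs hCB hL' hθ0 hθ1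
    (taylorSplitΦ_rescale _ hw0 hT) (flatKernelCauchyΦ_rescale_g hL hγ hγ1 hr hC hK) (kernelSizeΦ_rescale hL hγ hγ1 hr hCE hE)
    hR (cfgSizeΦ_rescale hL hγ hγ1 hr hS) (cfgCauchyΦ_rescale hL hγ hγ1 hr hBC)

/-- **THE LANDED COMPOSITION APPLIES BY NAME — VERBATIM K1a ROW OF RECORD** (no `g` in K1a; interpolation exponent `0 < t ≤ 1`): honest rows for `(Φ, B)`
⟹ the local slack row at `σ = 7`, profile `θBal(b₀, p₀)`, rate `a(1-t)`. [cite: King1986, Prop. 3.6 (3.56) p.662; Balaban1985UV3, (28) p.263, (34) p.264] -/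
theorem polymerCauchyMinAtTSlack_of_honest_charts {D : AlphaDataT3 F γ} {PT : TermFn F} {Φ : ChartFam 𝕍 F} {e : VacFam F}
    {B : CfgFam 𝕍 F} {R : RemFam F} {b₀ p₀ κ a C C_E C_R C_s C_B r₀ t : ℝ}
    (hC : 0 ≤ C) (hCE : 0 ≤ C_E) (hCR : 0 ≤ C_R) (hCs : 0 ≤ C_s) (hCB : 0 ≤ C_B) (hL : 1 ≤ F.L) (hγ : 0 < γ) (hγ1 : γ ≤ 1)
    (hr : 0 ≤ r₀) (ha : 0 ≤ a) (ht : 0 < t) (ht1 : t ≤ 1)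
    (hθ0 : ∀ n, 0 ≤ θBal F.L γ b₀ p₀ n) (hθ1 : ∀ n, (C_s + C_B) * θBal F.L γ b₀ p₀ n ≤ 1)
    (hT : TaylorSplitΦ PT Φ e B R) (hK : FlatKernelCauchyΦ D Φ κ a C) (hE : KernelSizeΦg D Φ κ C_E)
    (hR : RemainderSmallΦ D R b₀ p₀ κ C_R) (hS : CfgSizeΦr D B b₀ p₀ r₀ C_s) (hBC : CfgCauchyΦr D B b₀ p₀ r₀ a C_B fun _ => 1) :
    PolymerCauchyMinAtTSlack D PT b₀ p₀ κ (a * (1 - t)) 7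
      (5 * (C_s ^ 2 * (C ^ (1 - t) * (2 * C_E) ^ t * logPowConst (6 * r₀) t) +
        6 * C_s * C_B * (C_E * logPowConst (6 * r₀) 1)) + 2 * C_R) := by
  have hL' : 1 ≤ (F.L : ℝ) := by exact_mod_cast hL
  have hw0 : ∀ i, collarW F.L γ r₀ i ≠ 0 := fun i => (collarW_pos hL hγ hγ1 hr i).ne'
  have hM1 : 0 ≤ logPowConst (6 * r₀) 1 := (logPowConst_pos (by nlinarith) one_pos).le
  have hMt : 0 ≤ logPowConst (6 * r₀) t := (logPowConst_pos (by nlinarith) ht).le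
  have hC' : 0 ≤ C ^ (1 - t) * (2 * C_E) ^ t * logPowConst (6 * r₀) t :=
    mul_nonneg (mul_nonneg (Real.rpow_nonneg hC _) (Real.rpow_nonneg (by linarith) _)) hMt
  have ha' : a * (1 - t) ≤ a := by nlinarith
  exact polymerCauchyMinAtTSlack_of_charts hC' (mul_nonneg hCE hM1) hCR hCs hCB hL' hθ0 hθ1
    (taylorSplitΦ_rescale _ hw0 hT) (flatKernelCauchyΦ_rescale hL hγ hγ1 hr hC hCE ht ht1 hK hE)
    (kernelSizeΦ_rescale hL hγ hγ1 hr hCE hE) hR (cfgSizeΦ_rescale hL hγ hγ1 hr hS)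
    (cfgCauchyΦ_rate_mono hL hCB hθ0 (fun _ => zero_le_one) ha' (cfgCauchyΦ_rescale hL hγ hγ1 hr hBC))

end Transfer

/-! ## §5 Step (iii) in honest currency: the displayed chart row WITH its coupling ⟹ `KernelSizeΦg` and the honest Taylor rest -/


section Coupling2

variable {L : ℕ} {γ r₀ : ℝ}

/-- The birth couplings along the hierarchy: `log g_{n+m}⁻¹ = log g_n⁻¹ + ½ log Lᵐ`. [cite: Balaban1985UV3, (3) p.256] -/
theorem log_inv_gCo_add (hL : 1 ≤ L) (hγ : 0 < γ) (n m : ℕ) :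
    Real.log (gCo L γ (n + m))⁻¹ = Real.log (gCo L γ n)⁻¹ + Real.log (((L : ℝ) ^ m)⁻¹)⁻¹ / 2 := by
  have hL0 : (0 : ℝ) < L := by exact_mod_cast (show 0 < L by omega)
  have hA : 0 < γ * ((L : ℝ)⁻¹) ^ n := mul_pos hγ (pow_pos (inv_pos.mpr hL0) n)
  have hx : 0 < ((L : ℝ)⁻¹) ^ m := pow_pos (inv_pos.mpr hL0) m
  unfold gCo
  rw [pow_add, ← mul_assoc, Real.sqrt_mul hA.le, inv_inv]
  simp only [Real.log_inv]
  rw [Real.log_mul (Real.sqrt_pos.mpr hA).ne' (Real.sqrt_pos.mpr hx).ne', Real.log_sqrt hx.le]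
  simp only [inv_pow, Real.log_inv]
  ring

/-- **SPLITTING OF THE COLLAR WEIGHT ALONG THE HIERARCHY**: `λ_{n+m} ≤ λ_n · (1 + log Lᵐ)^{r₀}` (`1 + a + u/2 ≤ (1+a)(1+u)`). [cite: Balaban1985UV3, (7) p.257] -/
theorem collarW_add_le (hL : 1 ≤ L) (hγ : 0 < γ) (hγ1 : γ ≤ 1) (hr : 0 ≤ r₀) (n m : ℕ) :
    collarW L γ r₀ (n + m) ≤ collarW L γ r₀ n * (1 + Real.log (((L : ℝ) ^ m)⁻¹)⁻¹) ^ r₀ := by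
  have ha := B10.log_inv_nonneg_of_le_one (gCo_pos hL hγ n) (gCo_le_one hL hγ hγ1 n)
  have hL1 : (1 : ℝ) ≤ L := by exact_mod_cast hL
  have hx0 : 0 < ((L : ℝ) ^ m)⁻¹ := by positivity
  have hx1 : ((L : ℝ) ^ m)⁻¹ ≤ 1 := inv_le_one_of_one_le₀ (one_le_pow₀ hL1)
  have hu := B10.log_inv_nonneg_of_le_one hx0 hx1
  unfold collarW B10.rFun
  rw [log_inv_gCo_add hL hγ n m, ← Real.mul_rpow (by linarith) (by linarith)]
  exact Real.rpow_le_rpow (by linarith) (by nlinarith [mul_nonneg ha hu]) hr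

/-- **The coupling pays any power of the collar**: `λ_i^d · g_i ≤ M(d·r₀, 1)`. [cite: Balaban1985UV3, (7) p.257] -/
theorem collarW_pow_mul_gCo_le' (hL : 1 ≤ L) (hγ : 0 < γ) (hγ1 : γ ≤ 1) (hr : 0 ≤ r₀) (d i : ℕ) :
    collarW L γ r₀ i ^ d * gCo L γ i ≤ logPowConst (d * r₀) 1 := by
  have hg := gCo_pos hL hγ i
  have hg1 := gCo_le_one hL hγ hγ1 i
  have hu := B10.log_inv_nonneg_of_le_one hg hg1
  have hpow : collarW L γ r₀ i ^ d = (1 + Real.log (gCo L γ i)⁻¹) ^ ((d : ℝ) * r₀) := by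
    unfold collarW B10.rFun
    rw [← Real.rpow_natCast, ← Real.rpow_mul (by linarith)]
    congr 1
    ring
  rw [hpow, mul_comm]
  exact mul_logpow_le hg hg1 (mul_nonneg (Nat.cast_nonneg d) hr)

end Coupling2

end Summit.QuantumFields.YangMills.Theorems.GlobalSlackKernelRescale

end
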